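import Summits.BirchSwinnertonDyer.BirchSwinnertonDyer.Theorems.ClassRecordThreeEulerHalvesAtThreeCoreVertexAdm
import HarnessLib

/-!
# T1 JET (cell `bsd-jet`), road K — STRIKE K5, step 6: the TWO-LEVEL walk — Jetchev 2008 Prop. 6.4
# «core vertices exist» (full form, admissibility-indexed) with the depth bookkeeping carried by classes
# at a HIGHER level `p^{k+s}`, so that NO hypothesis `m(c) < k` is needed

HONEST FRAMING (programme file §HONESTY, verbatim): «no tranche here proves BSD; ARM L moves the
LITERAL column of an r ≤ 1 census into the kernel-proved-modulo-named-print column.» THEOREMS of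
elementary finite-group theory ONLY (seat `bsd-jet-pv-1`, session g8; `--supports
stmt-BirchSwinnertonDyer-14418`, helper); 0 classes move.

WHY. `JET.Section6.exists_coreVertex_adm` (this seat, `Rank1ResidualJetCoreVertexWalkAdm.lean`) and
cell bsd-stepL's `exists_halfCoreVertex_adm` carry the depth of the derived points (`m(cnℓ) ≤ m(cn)`,
printed Prop. 6.4's «`m(cℓ₁) ≤ m(c)`» via Prop. 4.7) with the classes `κ_{cn,k}` AT THE LEVEL `p^k` OF
THE SELMER MODULES — which detect divisibility only below `k`, whence their hypothesis `h0 : m(c) < k`,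
and whence `JET.jetchevCoreVertexExistence_lt_of_namedPrint` (p543972) proves the reading binder K5
only with the premise `s < m`. The printed statement (Compos. Math. 144 (2008) Prop. 5.3, p. 823) has
no such premise. This file removes it abstractly: the Selmer-module bookkeeping stays at level `p^k`
(classes `κ̃_{cn}` of order `p^k` on the `ε` side), while the depth bookkeeping uses a SECOND family
`κ₂ n` in another group `G₂` (in the application `κ_{cn,k+s} ∈ H¹(K, E[p^{k+s}])`, `s = m(c)`, all
conductors of the walk having index `≥ k + s`) with its own localisations `loc₂`, its own `hordκ₂`
(§3.1 items 4–5 at level `k + s`) and Prop. 4.7 `h47₂` at level `k + s`, tied to the level-`k` walk by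
ONE hypothesis `hlink`: when Lemma 6.1 has made `ord loc_λ κ̃_{cn} = p^k`, then
`ord loc_λ κ_{cn,k+s} = p^{k+s−m(cn)}` (in the application: `ι_* κ̃_{cn} = p^{s−m(cn)} κ_{cn,k+s}` and
`ι_*` preserves local orders at a Kolyvagin `λ` of index `≥ k + s`). Then `m(cnℓ) ≤ m(cn)` follows at
level `k + s` exactly as before, with NO `m(c) < k`. Everything else is the text of the `_adm` files.
References (locators only, no cited FACT is declared): [cite: Jetchev2008, §3.1 items 4–7 (p. 817),
Prop. 4.7 (p. 820), Lemma 5.2, Lemma 6.1, Prop. 6.4 (p. 824)] [cite: McCallumLMS1991, §3 Cor. 3.2,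
§4 Lemma 4.6 (change of level)]. Design: no definitions; `Type*`-polymorphic. Axioms: `propext`,
`Classical.choice`, `Quot.sound`.
-/

set_option autoImplicit false

noncomputable section

open scoped Classical

namespace Summit.BirchSwinnertonDyer.Rank1Residual.JET.Section6

section Walk

variable {G G₂ : Type*} [AddCommGroup G] [AddCommGroup G₂] {P : Type*} [DecidableEq P]
  {L L₂ : P → Type*} [∀ ℓ, AddCommGroup (L ℓ)] [∀ ℓ, AddCommGroup (L₂ ℓ)]

/-- One step of the two-level walk at a conductor whose `−ε` side is non-zero (as
`halfCoreVertex_step_adm`, depth carried by `κ₂` at level `k + s`). -/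
theorem halfCoreVertex_step_two
    {p k s : ℕ} (hk : 1 ≤ k)
    (loc : ∀ ℓ : P, G →+ L ℓ) (Hf Htr : ∀ ℓ : P, Bool → AddSubgroup (L ℓ))
    (hdisj : ∀ ℓ s, Disjoint (Hf ℓ s) (Htr ℓ s))
    (Gs : Bool → AddSubgroup G) (Sel : Finset P → Bool → AddSubgroup G)
    (Rel : Finset P → P → Bool → AddSubgroup G) (hSelGs : ∀ n s, Sel n s ≤ Gs s)
    (Adm : Finset P → P → Prop) (hAdm : ∀ n ℓ, Adm n ℓ → ℓ ∉ n)
    (hfin : ∀ n ℓ s, Adm n ℓ → Finite (Rel n ℓ s))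
    (hSel : ∀ n ℓ s, Adm n ℓ → Sel n s = Rel n ℓ s ⊓ (Hf ℓ s).comap (loc ℓ))
    (hSelT : ∀ n ℓ s, Adm n ℓ → Sel (insert ℓ n) s = Rel n ℓ s ⊓ (Htr ℓ s).comap (loc ℓ))
    (hPT : ∀ n ℓ s, Adm n ℓ → Nat.card ((Rel n ℓ s).map (loc ℓ)) = p ^ k)
    (e : Finset P → Bool) (he : ∀ n ℓ, Adm n ℓ → e (insert ℓ n) = !e n)
    (h61 : ∀ (s : Bool) (x y : G), x ∈ Gs s → y ∈ Gs (!s) → y ≠ 0 → ∀ n : Finset P,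
      ∃ ℓ, Adm n ℓ ∧ addOrderOf (loc ℓ x) = addOrderOf x ∧ addOrderOf (loc ℓ y) = addOrderOf y)
    (M mdiv mc : Finset P → ℕ∞) (hm : ∀ n, mdiv n < M n → mc n ≤ mdiv n)
    (hM : ∀ n, (k : ℕ∞) + mc ∅ ≤ M n) (hs : mc ∅ = (s : ℕ∞))
    (κt : Finset P → G)
    (hκt : ∀ n, mc n + k ≤ M n → κt n ∈ Sel n (e n) ∧ addOrderOf (κt n) = p ^ k)
    (loc₂ : ∀ ℓ : P, G₂ →+ L₂ ℓ) (κ₂ : Finset P → G₂)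
    (hordκ₂ : ∀ n (j : ℕ), j < k + s → p ^ (k + s - j) ∣ addOrderOf (κ₂ n) → mdiv n ≤ j)
    (h47₂ : ∀ n ℓ, Adm n ℓ → addOrderOf (loc₂ ℓ (κ₂ (insert ℓ n))) = addOrderOf (loc₂ ℓ (κ₂ n)))
    (hlink : ∀ n ℓ, Adm n ℓ → mc n ≤ mc ∅ → mc n + k ≤ M n → addOrderOf (loc ℓ (κt n)) = p ^ k →
      addOrderOf (loc₂ ℓ (κ₂ n)) = p ^ (k + s - (mc n).toNat))
    (n : Finset P) (hn : mc n ≤ mc ∅) (hfinSel : ∀ s, Finite (Sel n s))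
    (hne : Sel n (!e n) ≠ ⊥) :
    ∃ ℓ, ℓ ∉ n ∧ mc (insert ℓ n) ≤ mc n ∧ (∀ s, Finite (Sel (insert ℓ n) s)) ∧
      Nat.card (Sel (insert ℓ n) (e (insert ℓ n))) * Nat.card (Sel (insert ℓ n) (!e (insert ℓ n)))
        < Nat.card (Sel n (e n)) * Nat.card (Sel n (!e n)) := by
  -- bookkeeping in `ℕ∞`: `mc n` is finite, `< k`, and `mc n + k ≤ M n'` for every `n'`
  have hk0 : 0 < k := hk
  have hmcn_ne : mc n ≠ ⊤ := by
    intro h; rw [h, hs, top_le_iff] at hn; exact ENat.coe_ne_top s hn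
  set t : ℕ := (mc n).toNat with ht
  have hmct : mc n = (t : ℕ∞) := (ENat.coe_toNat hmcn_ne).symm
  have hts : t ≤ s := by
    have : ((t : ℕ) : ℕ∞) ≤ (s : ℕ∞) := hmct ▸ hs ▸ hn
    exact_mod_cast this
  have hMn : ∀ n', mc n + k ≤ M n' := fun n' =>
    calc mc n + (k : ℕ∞) ≤ mc ∅ + k := add_le_add hn le_rfl
      _ = (k : ℕ∞) + mc ∅ := add_comm _ _
      _ ≤ M n' := hM n'
  -- the class `κ̃` at `cn`
  obtain ⟨hκtSel, hκtord⟩ := hκt n (hMn n)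
  -- a non-zero class on the `−ε(cn)` side
  obtain ⟨y, hySel, hy0⟩ : ∃ y ∈ Sel n (!e n), y ≠ 0 := by
    rcases (Sel n (!e n)).bot_or_exists_ne_zero with h | ⟨y, hy, hy0⟩
    · exact (hne h).elim
    · exact ⟨y, hy, hy0⟩
  -- Lemma 6.1: choose `ℓ ∉ n`
  obtain ⟨ℓ, hℓn, hℓx, hℓy⟩ :=
    h61 (e n) (κt n) y (hSelGs _ _ hκtSel) (hSelGs _ _ hySel) hy0 n
  rw [hκtord] at hℓx
  haveI : ∀ s, Finite (Rel n ℓ s) := fun s => hfin n ℓ s hℓn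
  haveI : ∀ s, Finite ((Rel n ℓ s).map (loc ℓ)) := fun s => finite_map_of_finite (loc ℓ) _
  -- ε-side: `Sel n (e n) = Rel`, `Sel n⁺ (e n) = Rel ⊓ ker`, `#Sel n (e n) = #Sel n⁺ (e n) · p^k`
  have hxRel : κt n ∈ Rel n ℓ (e n) := by
    have := hκtSel; rw [hSel n ℓ (e n) hℓn] at this; exact this.1
  have hxf : loc ℓ (κt n) ∈ Hf ℓ (e n) := by
    have := hκtSel; rw [hSel n ℓ (e n) hℓn] at this; exact this.2
  obtain ⟨hA1, hA2, hA3⟩ := lozenge_epsSide (loc ℓ) (Rel n ℓ (e n)) (Hf ℓ (e n)) (Htr ℓ (e n))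
    (hdisj ℓ (e n)) hxRel hxf (by rw [hPT n ℓ (e n) hℓn, hℓx])
  have hSel_e : Sel n (e n) = Rel n ℓ (e n) := by rw [hSel n ℓ (e n) hℓn, hA1]
  have hSelT_e : Sel (insert ℓ n) (e n) = Rel n ℓ (e n) ⊓ (loc ℓ).ker := by
    rw [hSelT n ℓ (e n) hℓn, hA2]
  have hcard_e : Nat.card (Sel n (e n)) = Nat.card (Sel (insert ℓ n) (e n)) * p ^ k := by
    rw [hSel_e, hSelT_e, hA3, hℓx]
  -- −ε-side: `#Sel n⁺ (!e n) · ord(y)² ≤ p^k · #Sel n (!e n)`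
  have hyRel : y ∈ Rel n ℓ (!e n) := by
    have := hySel; rw [hSel n ℓ (!e n) hℓn] at this; exact this.1
  have hyf : loc ℓ y ∈ Hf ℓ (!e n) := by
    have := hySel; rw [hSel n ℓ (!e n) hℓn] at this; exact this.2
  have hB := lozenge_negSide (loc ℓ) (Rel n ℓ (!e n)) (Hf ℓ (!e n)) (Htr ℓ (!e n))
    (hdisj ℓ (!e n)) hyRel hyf
  rw [hPT n ℓ (!e n) hℓn, hℓy, ← hSel n ℓ (!e n) hℓn, ← hSelT n ℓ (!e n) hℓn] at hB
  -- `ord y ≥ 2`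
  have hordy : 2 ≤ addOrderOf y := by
    haveI := hfinSel (!e n)
    have hdvd : addOrderOf y ∣ Nat.card (Sel n (!e n)) :=
      (Sel n (!e n)).addOrderOf_dvd_natCard hySel
    have hcpos : 0 < Nat.card (Sel n (!e n)) := Nat.card_pos
    have hpos : 0 < addOrderOf y := Nat.pos_of_dvd_of_pos hdvd hcpos
    have hne1 : addOrderOf y ≠ 1 := by rwa [Ne, AddMonoid.addOrderOf_eq_one_iff]
    omega
  -- finiteness at `n⁺`
  have hfinT : ∀ s, Finite (Sel (insert ℓ n) s) := by
    intro s; rw [hSelT n ℓ s hℓn]; exact finite_of_le' inf_le_left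
  -- `m(cnℓ) ≤ m(cn)` (Prop. 4.7 + §3.1 bookkeeping)
  have hmc : mc (insert ℓ n) ≤ mc n := by
    have hord₂ : addOrderOf (loc₂ ℓ (κ₂ n)) = p ^ (k + s - t) := hlink n ℓ hℓn hn (hMn n) hℓx
    have hdvd : p ^ (k + s - t) ∣ addOrderOf (κ₂ (insert ℓ n)) := by
      rw [← hord₂, ← h47₂ n ℓ hℓn]
      exact addOrderOf_map_dvd (loc₂ ℓ) _
    have h1 : mdiv (insert ℓ n) ≤ (t : ℕ∞) := hordκ₂ _ t (by omega) hdvd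
    have h2 : mdiv (insert ℓ n) < M (insert ℓ n) := by
      calc mdiv (insert ℓ n) ≤ (t : ℕ∞) := h1
        _ = mc n := hmct.symm
        _ < mc n + k := by
            rw [hmct]
            exact_mod_cast Nat.lt_add_of_pos_right hk0
        _ ≤ M (insert ℓ n) := hMn _
    calc mc (insert ℓ n) ≤ mdiv (insert ℓ n) := hm _ h2
      _ ≤ (t : ℕ∞) := h1
      _ = mc n := hmct.symm
  -- the potential drops
  refine ⟨ℓ, hAdm n ℓ hℓn, hmc, hfinT, ?_⟩
  have he' : e (insert ℓ n) = !e n := he n ℓ hℓn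
  rw [he', Bool.not_not, hcard_e]
  haveI := hfinT (e n)
  haveI := hfinT (!e n)
  have hpos1 : 0 < Nat.card (Sel (insert ℓ n) (e n)) := Nat.card_pos
  have hpos2 : 0 < Nat.card (Sel (insert ℓ n) (!e n)) := Nat.card_pos
  -- `#T(!e) * ord(y)^2 ≤ p^k * #Sel n (!e n)` with `ord y ≥ 2`
  have h4 : Nat.card (Sel (insert ℓ n) (!e n)) * 4 ≤ p ^ k * Nat.card (Sel n (!e n)) :=
    le_trans (Nat.mul_le_mul_left _ (by nlinarith [hordy])) hB
  nlinarith [h4, hpos1, hpos2]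

/-- The step of the two-level walk AT a half-core vertex (as `coreVertex_stepAtHalfCore_adm`, depth
carried by `κ₂` at level `k + s`). -/
theorem coreVertex_stepAtHalfCore_two
    {p k s : ℕ} (hp : p.Prime) (hk : 1 ≤ k)
    (loc : ∀ ℓ : P, G →+ L ℓ) (Hf Htr : ∀ ℓ : P, Bool → AddSubgroup (L ℓ))
    (hdisj : ∀ ℓ s, Disjoint (Hf ℓ s) (Htr ℓ s))
    (Gs : Bool → AddSubgroup G) (Sel : Finset P → Bool → AddSubgroup G)
    (Rel : Finset P → P → Bool → AddSubgroup G) (hSelGs : ∀ n s, Sel n s ≤ Gs s)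
    (Adm : Finset P → P → Prop) (hAdm : ∀ n ℓ, Adm n ℓ → ℓ ∉ n)
    (hfin : ∀ n ℓ s, Adm n ℓ → Finite (Rel n ℓ s))
    (hSel : ∀ n ℓ s, Adm n ℓ → Sel n s = Rel n ℓ s ⊓ (Hf ℓ s).comap (loc ℓ))
    (hSelT : ∀ n ℓ s, Adm n ℓ → Sel (insert ℓ n) s = Rel n ℓ s ⊓ (Htr ℓ s).comap (loc ℓ))
    (hPT : ∀ n ℓ s, Adm n ℓ → Nat.card ((Rel n ℓ s).map (loc ℓ)) = p ^ k)
    (e : Finset P → Bool) (he : ∀ n ℓ, Adm n ℓ → e (insert ℓ n) = !e n)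
    (h61 : ∀ (s : Bool) (x y : G), x ∈ Gs s → y ∈ Gs (!s) → y ≠ 0 → ∀ n : Finset P,
      ∃ ℓ, Adm n ℓ ∧ addOrderOf (loc ℓ x) = addOrderOf x ∧ addOrderOf (loc ℓ y) = addOrderOf y)
    (M mdiv mc : Finset P → ℕ∞) (hm : ∀ n, mdiv n < M n → mc n ≤ mdiv n)
    (hM : ∀ n, (k : ℕ∞) + mc ∅ ≤ M n) (hs : mc ∅ = (s : ℕ∞))
    (κt : Finset P → G)
    (hκt : ∀ n, mc n + k ≤ M n → κt n ∈ Sel n (e n) ∧ addOrderOf (κt n) = p ^ k)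
    (loc₂ : ∀ ℓ : P, G₂ →+ L₂ ℓ) (κ₂ : Finset P → G₂)
    (hordκ₂ : ∀ n (j : ℕ), j < k + s → p ^ (k + s - j) ∣ addOrderOf (κ₂ n) → mdiv n ≤ j)
    (h47₂ : ∀ n ℓ, Adm n ℓ → addOrderOf (loc₂ ℓ (κ₂ (insert ℓ n))) = addOrderOf (loc₂ ℓ (κ₂ n)))
    (hlink : ∀ n ℓ, Adm n ℓ → mc n ≤ mc ∅ → mc n + k ≤ M n → addOrderOf (loc ℓ (κt n)) = p ^ k →
      addOrderOf (loc₂ ℓ (κ₂ n)) = p ^ (k + s - (mc n).toNat))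
    (n : Finset P) (hn : mc n ≤ mc ∅) (hB : Sel n (!e n) = ⊥) :
    ∃ ℓ, ℓ ∉ n ∧ mc (insert ℓ n) ≤ mc n ∧ (∀ s, Finite (Sel (insert ℓ n) s)) ∧
      Nat.card (Sel (insert ℓ n) (e (insert ℓ n))) = p ^ k ∧
      Nat.card (Sel (insert ℓ n) (!e (insert ℓ n))) * p ^ k = Nat.card (Sel n (e n)) := by
  -- bookkeeping in `ℕ∞`: `mc n` is finite, `< k`, and `mc n + k ≤ M n'` for every `n'`
  have hk0 : 0 < k := hk
  have hmcn_ne : mc n ≠ ⊤ := by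
    intro h; rw [h, hs, top_le_iff] at hn; exact ENat.coe_ne_top s hn
  set t : ℕ := (mc n).toNat with ht
  have hmct : mc n = (t : ℕ∞) := (ENat.coe_toNat hmcn_ne).symm
  have hts : t ≤ s := by
    have : ((t : ℕ) : ℕ∞) ≤ (s : ℕ∞) := hmct ▸ hs ▸ hn
    exact_mod_cast this
  have hMn : ∀ n', mc n + k ≤ M n' := fun n' =>
    calc mc n + (k : ℕ∞) ≤ mc ∅ + k := add_le_add hn le_rfl
      _ = (k : ℕ∞) + mc ∅ := add_comm _ _
      _ ≤ M n' := hM n'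
  have hpk1 : 1 < p ^ k := Nat.one_lt_pow hk0.ne' hp.one_lt
  -- the class `κ̃` at `cn`, non-zero
  obtain ⟨hκtSel, hκtord⟩ := hκt n (hMn n)
  have hκt0 : κt n ≠ 0 := by
    intro h
    rw [h, addOrderOf_zero] at hκtord
    omega
  -- Lemma 6.1 for the pair (`0` on the `−ε` side, `κ̃` on the `ε` side): choose `ℓ ∉ n`
  have hκtGs : κt n ∈ Gs (!!e n) := by rw [Bool.not_not]; exact hSelGs _ _ hκtSel
  obtain ⟨ℓ, hA, -, hℓy⟩ := h61 (!e n) 0 (κt n) (AddSubgroup.zero_mem _) hκtGs hκt0 n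
  have hℓn : ℓ ∉ n := hAdm n ℓ hA
  rw [hκtord] at hℓy
  haveI : ∀ s, Finite (Rel n ℓ s) := fun s => hfin n ℓ s hA
  haveI : ∀ s, Finite ((Rel n ℓ s).map (loc ℓ)) := fun s => finite_map_of_finite (loc ℓ) _
  -- ε-side: `Sel n (e n) = Rel`, `Sel n⁺ (e n) = Rel ⊓ ker`, `#Sel n (e n) = #Sel n⁺ (e n) · p^k`
  have hxRel : κt n ∈ Rel n ℓ (e n) := by
    have := hκtSel; rw [hSel n ℓ (e n) hA] at this; exact this.1
  have hxf : loc ℓ (κt n) ∈ Hf ℓ (e n) := by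
    have := hκtSel; rw [hSel n ℓ (e n) hA] at this; exact this.2
  obtain ⟨hA1, hA2, hA3⟩ := lozenge_epsSide (loc ℓ) (Rel n ℓ (e n)) (Hf ℓ (e n)) (Htr ℓ (e n))
    (hdisj ℓ (e n)) hxRel hxf (by rw [hPT n ℓ (e n) hA, hℓy])
  have hSel_e : Sel n (e n) = Rel n ℓ (e n) := by rw [hSel n ℓ (e n) hA, hA1]
  have hSelT_e : Sel (insert ℓ n) (e n) = Rel n ℓ (e n) ⊓ (loc ℓ).ker := by
    rw [hSelT n ℓ (e n) hA, hA2]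
  have hcard_e : Nat.card (Sel n (e n)) = Nat.card (Sel (insert ℓ n) (e n)) * p ^ k := by
    rw [hSel_e, hSelT_e, hA3, hℓy]
  -- −ε-side with `y = 0`: `#Sel n⁺ (!e n) ≤ p^k · #Sel n (!e n) = p^k`
  have hB' := lozenge_negSide (loc ℓ) (Rel n ℓ (!e n)) (Hf ℓ (!e n)) (Htr ℓ (!e n))
    (hdisj ℓ (!e n)) (y := 0) (AddSubgroup.zero_mem _) (by rw [map_zero]; exact AddSubgroup.zero_mem _)
  rw [hPT n ℓ (!e n) hA, map_zero, addOrderOf_zero, one_pow, mul_one, ← hSel n ℓ (!e n) hA,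
    ← hSelT n ℓ (!e n) hA, hB, AddSubgroup.card_bot, mul_one] at hB'
  -- finiteness at `n⁺`
  have hfinT : ∀ s, Finite (Sel (insert ℓ n) s) := by
    intro s; rw [hSelT n ℓ s hA]; exact finite_of_le' inf_le_left
  -- `m(cnℓ) ≤ m(cn)` (Prop. 4.7 + §3.1 bookkeeping), exactly as in `halfCoreVertex_step`
  have hmc : mc (insert ℓ n) ≤ mc n := by
    have hord₂ : addOrderOf (loc₂ ℓ (κ₂ n)) = p ^ (k + s - t) := hlink n ℓ hA hn (hMn n) hℓy
    have hdvd : p ^ (k + s - t) ∣ addOrderOf (κ₂ (insert ℓ n)) := by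
      rw [← hord₂, ← h47₂ n ℓ hA]
      exact addOrderOf_map_dvd (loc₂ ℓ) _
    have h1 : mdiv (insert ℓ n) ≤ (t : ℕ∞) := hordκ₂ _ t (by omega) hdvd
    have h2 : mdiv (insert ℓ n) < M (insert ℓ n) := by
      calc mdiv (insert ℓ n) ≤ (t : ℕ∞) := h1
        _ = mc n := hmct.symm
        _ < mc n + k := by
            rw [hmct]
            exact_mod_cast Nat.lt_add_of_pos_right hk0
        _ ≤ M (insert ℓ n) := hMn _
    calc mc (insert ℓ n) ≤ mdiv (insert ℓ n) := hm _ h2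
      _ ≤ (t : ℕ∞) := h1
      _ = mc n := hmct.symm
  -- the new `ε(cnℓ) = −ε(cn)` side contains `κ̃_{cnℓ}` of order `p^k`, hence has exactly `p^k` elements
  have he' : e (insert ℓ n) = !e n := he n ℓ hA
  obtain ⟨hκtSel', hκtord'⟩ := hκt (insert ℓ n) (le_trans (add_le_add hmc le_rfl) (hMn _))
  rw [he'] at hκtSel'
  have hge : p ^ k ≤ Nat.card (Sel (insert ℓ n) (!e n)) := by
    haveI := hfinT (!e n)
    have hdvd : addOrderOf (κt (insert ℓ n)) ∣ Nat.card (Sel (insert ℓ n) (!e n)) :=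
      (Sel (insert ℓ n) (!e n)).addOrderOf_dvd_natCard hκtSel'
    rw [hκtord'] at hdvd
    exact Nat.le_of_dvd Nat.card_pos hdvd
  have hcardA : Nat.card (Sel (insert ℓ n) (!e n)) = p ^ k := le_antisymm hB' hge
  refine ⟨ℓ, hℓn, hmc, hfinT, ?_, ?_⟩
  · rw [he']; exact hcardA
  · rw [he', Bool.not_not, ← hcard_e]

/-- **Jetchev 2008, Prop. 6.4 (p. 824) = printed Prop. 5.3 (p. 823), abstract kernel form, TWO-LEVEL
walk — CORE VERTICES (full printed sense) EXIST, with NO hypothesis `m(c) < k`.** Data as in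
`exists_coreVertex_adm` except: no level-`k` classes `κ_{cn,k}`; instead a second family `κ₂` (level
`k + s`, `s = m(c)`) with `hordκ₂`, `h47₂` and the link `hlink` (module docstring). CONCLUSION: some
`c' = c·n` has `𝓗_{𝓕(c')}^{−ε(c')} = 0`, `𝓗_{𝓕(c')}^{ε(c')}` cyclic of order `p^k`, and `m(c') ≤ m(c)`.
[cite: Jetchev2008, Prop. 6.4 (p. 824); §3.1, Prop. 4.7, Lemma 5.2, Lemma 6.1] [cite: McCallumLMS1991, Cor. 3.2, Lemma 4.6] -/
theorem exists_coreVertex_two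
    {p k s : ℕ} (hp : p.Prime) (hk : 1 ≤ k)
    (loc : ∀ ℓ : P, G →+ L ℓ) (Hf Htr : ∀ ℓ : P, Bool → AddSubgroup (L ℓ))
    (hdisj : ∀ ℓ s, Disjoint (Hf ℓ s) (Htr ℓ s))
    (Gs : Bool → AddSubgroup G) (Sel : Finset P → Bool → AddSubgroup G)
    (Rel : Finset P → P → Bool → AddSubgroup G) (hSelGs : ∀ n s, Sel n s ≤ Gs s)
    (Adm : Finset P → P → Prop) (hAdm : ∀ n ℓ, Adm n ℓ → ℓ ∉ n)
    (hfin : ∀ n ℓ s, Adm n ℓ → Finite (Rel n ℓ s))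
    (hSel : ∀ n ℓ s, Adm n ℓ → Sel n s = Rel n ℓ s ⊓ (Hf ℓ s).comap (loc ℓ))
    (hSelT : ∀ n ℓ s, Adm n ℓ → Sel (insert ℓ n) s = Rel n ℓ s ⊓ (Htr ℓ s).comap (loc ℓ))
    (hPT : ∀ n ℓ s, Adm n ℓ → Nat.card ((Rel n ℓ s).map (loc ℓ)) = p ^ k)
    (e : Finset P → Bool) (he : ∀ n ℓ, Adm n ℓ → e (insert ℓ n) = !e n)
    (h61 : ∀ (s : Bool) (x y : G), x ∈ Gs s → y ∈ Gs (!s) → y ≠ 0 → ∀ n : Finset P,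
      ∃ ℓ, Adm n ℓ ∧ addOrderOf (loc ℓ x) = addOrderOf x ∧ addOrderOf (loc ℓ y) = addOrderOf y)
    (M mdiv mc : Finset P → ℕ∞) (hm : ∀ n, mdiv n < M n → mc n ≤ mdiv n)
    (hM : ∀ n, (k : ℕ∞) + mc ∅ ≤ M n) (hs : mc ∅ = (s : ℕ∞))
    (κt : Finset P → G)
    (hκt : ∀ n, mc n + k ≤ M n → κt n ∈ Sel n (e n) ∧ addOrderOf (κt n) = p ^ k)
    (loc₂ : ∀ ℓ : P, G₂ →+ L₂ ℓ) (κ₂ : Finset P → G₂)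
    (hordκ₂ : ∀ n (j : ℕ), j < k + s → p ^ (k + s - j) ∣ addOrderOf (κ₂ n) → mdiv n ≤ j)
    (h47₂ : ∀ n ℓ, Adm n ℓ → addOrderOf (loc₂ ℓ (κ₂ (insert ℓ n))) = addOrderOf (loc₂ ℓ (κ₂ n)))
    (hlink : ∀ n ℓ, Adm n ℓ → mc n ≤ mc ∅ → mc n + k ≤ M n → addOrderOf (loc ℓ (κt n)) = p ^ k →
      addOrderOf (loc₂ ℓ (κ₂ n)) = p ^ (k + s - (mc n).toNat)) :
    ∃ n : Finset P, Sel n (!e n) = ⊥ ∧ Nat.card (Sel n (e n)) = p ^ k ∧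
      IsAddCyclic (Sel n (e n)) ∧ mc n ≤ mc ∅ := by
  have hk0 : 0 < k := hk
  have hpk1 : 1 < p ^ k := Nat.one_lt_pow hk0.ne' hp.one_lt
  have hMn : ∀ n : Finset P, mc n ≤ mc ∅ → mc n + k ≤ M n := fun n hn =>
    calc mc n + (k : ℕ∞) ≤ mc ∅ + k := add_le_add hn le_rfl
      _ = (k : ℕ∞) + mc ∅ := add_comm _ _
      _ ≤ M n := hM n
  -- cyclicity at the end: `κ̃_{cn}` of order `p^k` in a group of order `p^k`
  have hcyc : ∀ n : Finset P, mc n ≤ mc ∅ → (∀ s, Finite (Sel n s)) →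
      Nat.card (Sel n (e n)) = p ^ k → IsAddCyclic (Sel n (e n)) := by
    intro n hn hfinSel hcard
    haveI := hfinSel (e n)
    obtain ⟨hκtSel, hκtord⟩ := hκt n (hMn n hn)
    rw [isAddCyclic_iff_exists_addOrderOf_eq_natCard]
    refine ⟨⟨κt n, hκtSel⟩, ?_⟩
    rw [← AddSubgroup.addOrderOf_coe, hκtord, hcard]
  -- the inductive claim, on the potential, for conductors with finite Selmer modules
  have claim : ∀ (N : ℕ) (n : Finset P), mc n ≤ mc ∅ → (∀ s, Finite (Sel n s)) →
      Nat.card (Sel n (e n)) * Nat.card (Sel n (!e n)) ≤ N →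
      ∃ n' : Finset P, Sel n' (!e n') = ⊥ ∧ Nat.card (Sel n' (e n')) = p ^ k ∧
        (∀ s, Finite (Sel n' s)) ∧ mc n' ≤ mc ∅ := by
    intro N
    induction N using Nat.strong_induction_on with
    | _ N ih =>
      intro n hn hfinSel hΦ
      by_cases hB : Sel n (!e n) = ⊥
      · by_cases hA : Nat.card (Sel n (e n)) = p ^ k
        · exact ⟨n, hB, hA, hfinSel, hn⟩
        -- a half-core vertex that is not a core vertex: one step that keeps the potential …
        obtain ⟨ℓ, -, hmc, hfinT, hcardA, hcardB⟩ := coreVertex_stepAtHalfCore_two hp hk loc Hf Htr hdisj Gs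
          Sel Rel hSelGs Adm hAdm hfin hSel hSelT hPT e he h61 M mdiv mc hm hM hs κt hκt loc₂ κ₂ hordκ₂ h47₂ hlink n hn hB
        have hn' : mc (insert ℓ n) ≤ mc ∅ := hmc.trans hn
        by_cases hB' : Sel (insert ℓ n) (!e (insert ℓ n)) = ⊥
        · exact ⟨insert ℓ n, hB', hcardA, hfinT, hn'⟩
        -- … followed by one step that lowers it
        obtain ⟨ℓ', -, hmc', hfinT', hlt⟩ := halfCoreVertex_step_two hk loc Hf Htr hdisj Gs Sel Rel hSelGs Adm
          hAdm hfin hSel hSelT hPT e he h61 M mdiv mc hm hM hs κt hκt loc₂ κ₂ hordκ₂ h47₂ hlink (insert ℓ n) hn' hfinT hB'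
        have hΦ' : Nat.card (Sel (insert ℓ n) (e (insert ℓ n))) *
            Nat.card (Sel (insert ℓ n) (!e (insert ℓ n))) ≤ N := by
          rw [hcardA, mul_comm, hcardB]
          calc Nat.card (Sel n (e n)) = Nat.card (Sel n (e n)) * Nat.card (Sel n (!e n)) := by
                rw [hB, AddSubgroup.card_bot, mul_one]
            _ ≤ N := hΦ
        have hltN : Nat.card (Sel (insert ℓ' (insert ℓ n)) (e (insert ℓ' (insert ℓ n)))) *
            Nat.card (Sel (insert ℓ' (insert ℓ n)) (!e (insert ℓ' (insert ℓ n)))) < N :=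
          lt_of_lt_of_le hlt hΦ'
        exact ih _ hltN (insert ℓ' (insert ℓ n)) (hmc'.trans hn') hfinT' le_rfl
      · obtain ⟨ℓ, -, hmc, hfinT, hlt⟩ := halfCoreVertex_step_two hk loc Hf Htr hdisj Gs Sel Rel hSelGs Adm
          hAdm hfin hSel hSelT hPT e he h61 M mdiv mc hm hM hs κt hκt loc₂ κ₂ hordκ₂ h47₂ hlink n hn hfinSel hB
        exact ih _ (lt_of_lt_of_le hlt hΦ) (insert ℓ n) (hmc.trans hn) hfinT le_rfl
  -- start of the walk: Lemma 6.1 for (`0`, `κ̃_c`) gives some `ℓ`, whence finiteness at `c`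
  have hM0 : mc ∅ + k ≤ M ∅ := hMn ∅ le_rfl
  obtain ⟨hκtSel, hκtord⟩ := hκt ∅ hM0
  have hκt0 : κt ∅ ≠ 0 := by
    intro h
    rw [h, addOrderOf_zero] at hκtord
    omega
  have hκtGs : κt ∅ ∈ Gs (!!e ∅) := by rw [Bool.not_not]; exact hSelGs _ _ hκtSel
  obtain ⟨ℓ, hA, -, -⟩ := h61 (!e ∅) 0 (κt ∅) (AddSubgroup.zero_mem _) hκtGs hκt0 ∅
  have hfin0 : ∀ s, Finite (Sel ∅ s) := by
    intro s
    haveI := hfin ∅ ℓ s hA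
    rw [hSel ∅ ℓ s hA]
    exact finite_of_le' inf_le_left
  obtain ⟨n, hB, hA, hfinSel, hn⟩ := claim _ ∅ le_rfl hfin0 le_rfl
  exact ⟨n, hB, hA, hcyc n hn hfinSel hA, hn⟩

end Walk

end Summit.BirchSwinnertonDyer.Rank1Residual.JET.Section6

end
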